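import Mathlib
import Summits.Ventures.PercRepro2.LocRows
import Summits.Ventures.PercRepro2.SwRow
import Summits.Ventures.PercRepro2.SwOut
import Summits.Ventures.PercRepro2.SwAllRow
import Summits.Ventures.PercRepro2.SwOutAll
import Summits.Ventures.PercRepro2.SwOutArmFlip
import Summits.Ventures.PercRepro2.SwOutArmThm
import Summits.Ventures.PercRepro2.SwOutCoreDefs
import Summits.Ventures.PercRepro2.SwOutBigBlockDefs
import Summits.Ventures.PercRepro2.SwOutMixedBaseDefs
import Summits.Ventures.PercRepro2.SwOutMixedBaseClasses
import Summits.Ventures.PercRepro2.SwOutMixedBaseHull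

/-!
# The mixed base: the dual base and the blue hull formula (blind cell PercRepro2, night-4 g17,
2026-08-27; proofs/NIGHT4-G17.md §4⁗)

The DUAL base `dualMixed σ` keeps the colour of every edge of a class (the arms' edges, the u–p
edges, the outside edges of `p`) and flips every other edge; it is again a `MixedBase` for the same
data (`MixedBase.dual`), and the blue colouring of a realisation is the realisation of the dual base
at the flipped point: `blue (mixedReal σ q) = mixedReal (dualMixed σ) (flipPt q)`.  Hence the blue
cluster of `h` at a point without blue-side leak (`LeakB q = LeakR (flipPt q)`) is `redSetM (flipPt q)`
— `h`, the blue u-arms, `u` when some u-arm is blue, `p` when moreover the u–p edges are blue, the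
blue h-piece, the blue far arms (`cluster_blue_mixedReal`) — and the hull of `h` lies in
`{h, u, p} ∪ arms` at every point without leak (`hull_mixedReal_subset`).
-/

namespace Summit.Ventures.PercRepro2

namespace BigBlock

open Hull LocRows

variable {V : Type*} {E : Type*}

open scoped Classical

section DualDefs

variable (ends : E → Sym2 V) (u p : V) {ι κ : Type*} (U : ι → Set V) (Ah : Set V) (F : κ → Set V)

/-- The edges of some class. -/
def classAll : Set E :=
  {e | ∃ j, e ∈ touches ends (U j)} ∪ touches ends Ah ∪ clsUP ends u p ∪ clsExt ends u p Ah ∪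
    {e | ∃ k, e ∈ touches ends (F k)}

/-- The dual base: the class edges keep their colour, every other edge is flipped. -/
noncomputable def dualMixed (σ : Config E) : Config E :=
  fun e => if e ∈ classAll ends u p U Ah F then σ e else !σ e

/-- The blue-side leaks: the red-side leaks of the flipped point. -/
def LeakB (q : Pt ι κ) : Prop := LeakR (flipPt q)

end DualDefs

section Dual

variable {ends : E → Sym2 V} {σ : Config E} {h u p : V} {ι κ : Type*} {U : ι → Set V} {Ah : Set V}
  {F : κ → Set V} (hb : MixedBase ends σ h u p U Ah F)
include hb

omit hb in
/-- The dual base on a class edge. -/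
lemma dualMixed_apply_of_mem {e : E} (he : e ∈ classAll ends u p U Ah F) :
    dualMixed ends u p U Ah F σ e = σ e := by
  simp [dualMixed, he]

omit hb in
/-- The dual base off the classes. -/
lemma dualMixed_apply_of_notMem {e : E} (he : e ∉ classAll ends u p U Ah F) :
    dualMixed ends u p U Ah F σ e = !σ e := by
  simp [dualMixed, he]

/-- An edge at `h` is a class edge. -/
lemma MixedBase.h_edge_mem_classAll {e : E} {x : V} (he : ends e = s(h, x)) :
    e ∈ classAll ends u p U Ah F := by
  rcases hb.h_edges e x he with ⟨j, hj⟩ | hj | ⟨k, hk⟩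
  · exact Or.inl (Or.inl (Or.inl (Or.inl ⟨j, x, hj, h, ends_swap he⟩)))
  · exact Or.inl (Or.inl (Or.inl (Or.inr ⟨x, hj, h, ends_swap he⟩)))
  · exact Or.inr ⟨k, x, hk, h, ends_swap he⟩

/-- An edge at `u` is a class edge. -/
lemma MixedBase.u_edge_mem_classAll {e : E} {x : V} (he : ends e = s(u, x)) :
    e ∈ classAll ends u p U Ah F := by
  rcases hb.u_edges e x he with ⟨j, hj⟩ | rfl
  · exact Or.inl (Or.inl (Or.inl (Or.inl ⟨j, x, hj, u, ends_swap he⟩)))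
  · exact Or.inl (Or.inl (Or.inr he))

/-- An edge at `p` is a class edge. -/
lemma MixedBase.p_edge_mem_classAll {e : E} {x : V} (he : ends e = s(p, x)) :
    e ∈ classAll ends u p U Ah F := by
  rcases hb.p_edges e x he with rfl | hx | ⟨_, _, hx⟩
  · exact Or.inl (Or.inl (Or.inr (ends_swap he)))
  · exact Or.inl (Or.inl (Or.inl (Or.inr ⟨x, hx, p, ends_swap he⟩)))
  · by_cases hxu : x = u
    · subst hxu; exact Or.inl (Or.inl (Or.inr (ends_swap he)))
    · exact Or.inl (Or.inr ⟨x, he, hxu, fun hxA => hx (Or.inl (Or.inr hxA))⟩)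

omit hb in
/-- An edge with an end in an arm is a class edge. -/
lemma MixedBase.arm_edge_mem_classAll {e : E} {x y : V} (he : ends e = s(x, y))
    (hx : x ∈ armsAll U Ah F) : e ∈ classAll ends u p U Ah F := by
  rcases hx with (hx | hx) | hx
  · obtain ⟨j, hj⟩ := Set.mem_iUnion.1 hx
    exact Or.inl (Or.inl (Or.inl (Or.inl ⟨j, x, hj, y, he⟩)))
  · exact Or.inl (Or.inl (Or.inl (Or.inr ⟨x, hx, y, he⟩)))
  · obtain ⟨k, hk⟩ := Set.mem_iUnion.1 hx
    exact Or.inr ⟨k, x, hk, y, he⟩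

/-- The dual base agrees with the base inside `S ∪ {h}` for an arm `S`. -/
lemma MixedBase.insideConfig_dualMixed (S : Set V) (hS : S ⊆ armsAll U Ah F) :
    insideConfig ends (S ∪ {h}) (dualMixed ends u p U Ah F σ) = insideConfig ends (S ∪ {h}) σ := by
  funext e
  simp only [insideConfig]
  by_cases hw : e ∈ within ends (S ∪ {h})
  · obtain ⟨x, hx, y, hy, hxy⟩ := hw
    have hc : e ∈ classAll ends u p U Ah F := by
      rcases hx with hx | hx
      · exact MixedBase.arm_edge_mem_classAll hxy (hS hx)
      · rw [Set.mem_singleton_iff] at hx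
        subst hx
        exact hb.h_edge_mem_classAll hxy
    rw [dualMixed_apply_of_mem hc]
  · rw [decide_eq_false hw]; simp

/-- **The dual base is a mixed base.** -/
theorem MixedBase.dual : MixedBase ends (dualMixed ends u p U Ah F σ) h u p U Ah F where
  hne_hu := hb.hne_hu
  hne_hp := hb.hne_hp
  hne_up := hb.hne_up
  h_notMem_U := hb.h_notMem_U
  u_notMem_U := hb.u_notMem_U
  p_notMem_U := hb.p_notMem_U
  h_notMem_Ah := hb.h_notMem_Ah
  u_notMem_Ah := hb.u_notMem_Ah
  p_notMem_Ah := hb.p_notMem_Ah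
  h_notMem_F := hb.h_notMem_F
  u_notMem_F := hb.u_notMem_F
  p_notMem_F := hb.p_notMem_F
  U_disj := hb.U_disj
  U_disj_Ah := hb.U_disj_Ah
  U_disj_F := hb.U_disj_F
  Ah_disj_F := hb.Ah_disj_F
  F_disj := hb.F_disj
  U_nonempty := hb.U_nonempty
  Ah_nonempty := hb.Ah_nonempty
  F_nonempty := hb.F_nonempty
  no_cross_UU := hb.no_cross_UU
  no_cross_UAh := hb.no_cross_UAh
  no_cross_UF := hb.no_cross_UF
  no_cross_AhF := hb.no_cross_AhF
  no_cross_FF := hb.no_cross_FF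
  h_edges := hb.h_edges
  u_edges := hb.u_edges
  p_edges := hb.p_edges
  u_adj_U := hb.u_adj_U
  h_red := fun e x he => by rw [dualMixed_apply_of_mem (hb.h_edge_mem_classAll he)]; exact hb.h_red e x he
  u_red := fun e x he => by rw [dualMixed_apply_of_mem (hb.u_edge_mem_classAll he)]; exact hb.u_red e x he
  dead_blue := fun e x he hx => by
    rw [dualMixed_apply_of_mem (hb.p_edge_mem_classAll he)]; exact hb.dead_blue e x he hx
  ext_blue := fun e x he hxu hxA => by
    rw [dualMixed_apply_of_mem (hb.p_edge_mem_classAll he)]; exact hb.ext_blue e x he hxu hxA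
  bdry_blue := fun e x y he hx hyh hyu hyp hy => by
    rw [dualMixed_apply_of_mem (MixedBase.arm_edge_mem_classAll he hx)]
    exact hb.bdry_blue e x y he hx hyh hyu hyp hy
  U_conn := fun j x hx => by
    rw [hb.insideConfig_dualMixed (U j) (fun y hy => Or.inl (Or.inl (Set.mem_iUnion.2 ⟨j, hy⟩)))]
    exact hb.U_conn j x hx
  Ah_conn := fun x hx => by
    rw [hb.insideConfig_dualMixed Ah (fun y hy => Or.inl (Or.inr hy))]
    exact hb.Ah_conn x hx
  F_conn := fun k x hx => by
    rw [hb.insideConfig_dualMixed (F k) (fun y hy => Or.inr (Set.mem_iUnion.2 ⟨k, hy⟩))]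
    exact hb.F_conn k x hx

/-- **The blue colouring of a realisation is the realisation of the dual base at the flipped
point.** -/
theorem MixedBase.blue_mixedReal (q : Pt ι κ) :
    blue (mixedReal ends u p U Ah F σ q) = mixedReal ends u p U Ah F (dualMixed ends u p U Ah F σ) (flipPt q) := by
  funext e
  simp only [blue]
  by_cases hU : ∃ j, e ∈ touches ends (U j)
  · obtain ⟨j, hj⟩ := hU
    rw [hb.mixedReal_apply_U hj, hb.dual.mixedReal_apply_U hj,
      dualMixed_apply_of_mem (Or.inl (Or.inl (Or.inl (Or.inl ⟨j, hj⟩))))]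
    simp only [flipPt, flipAll]
    by_cases hj' : q.1 j = true <;> simp [hj']
  by_cases hA : e ∈ touches ends Ah
  · rw [hb.mixedReal_apply_Ah hA, hb.dual.mixedReal_apply_Ah hA,
      dualMixed_apply_of_mem (Or.inl (Or.inl (Or.inl (Or.inr hA))))]
    simp only [flipPt]
    by_cases ha' : q.2.1 = true <;> simp [ha']
  by_cases hUP : e ∈ clsUP ends u p
  · rw [hb.mixedReal_apply_UP hUP, hb.dual.mixedReal_apply_UP hUP,
      dualMixed_apply_of_mem (Or.inl (Or.inl (Or.inr hUP)))]
    simp only [flipPt]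
    by_cases hc' : q.2.2.1 = true <;> simp [hc']
  by_cases hX : e ∈ clsExt ends u p Ah
  · rw [hb.mixedReal_apply_Ext hX, hb.dual.mixedReal_apply_Ext hX,
      dualMixed_apply_of_mem (Or.inl (Or.inr hX))]
    simp only [flipPt]
    by_cases hc' : q.2.2.2.1 = true <;> simp [hc']
  by_cases hF : ∃ k, e ∈ touches ends (F k)
  · obtain ⟨k, hk⟩ := hF
    rw [hb.mixedReal_apply_F hk, hb.dual.mixedReal_apply_F hk, dualMixed_apply_of_mem (Or.inr ⟨k, hk⟩)]
    simp only [flipPt, flipAll]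
    by_cases hk' : q.2.2.2.2 k = true <;> simp [hk']
  · simp only [not_exists] at hU hF
    have hc : e ∉ classAll ends u p U Ah F := by
      rintro ((((⟨j, hj⟩ | hj) | hj) | hj) | ⟨k, hk⟩)
      · exact hU j hj
      · exact hA hj
      · exact hUP hj
      · exact hX hj
      · exact hF k hk
    rw [MixedBase.mixedReal_apply_none hU hA hUP hX hF,
      MixedBase.mixedReal_apply_none hU hA hUP hX hF, dualMixed_apply_of_notMem hc]

/-- **The blue hull formula**: at a point without blue-side leak, the blue cluster of `h` is
`redSetM` of the flipped point. -/
theorem MixedBase.cluster_blue_mixedReal (hup : ∃ e, ends e = s(u, p)) {q : Pt ι κ}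
    (hq : ¬ LeakB q) :
    cluster ends (blue (mixedReal ends u p U Ah F σ q)) h = redSetM h u p U Ah F (flipPt q) := by
  rw [hb.blue_mixedReal]
  exact hb.dual.cluster_mixedReal hup hq

omit hb in
/-- `redSetM` lies in `{h, u, p}` with the arms. -/
lemma redSetM_subset {q : Pt ι κ} {x : V} (hx : x ∈ redSetM h u p U Ah F q) :
    x ∈ {h} ∪ {u} ∪ {p} ∪ armsAll U Ah F := by
  rw [mem_redSetM_iff] at hx
  rcases hx with rfl | ⟨j, _, hx⟩ | ⟨rfl, _⟩ | ⟨rfl, _⟩ | ⟨_, hx⟩ | ⟨k, _, hx⟩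
  · exact Or.inl (Or.inl (Or.inl rfl))
  · exact Or.inr (Or.inl (Or.inl (Set.mem_iUnion.2 ⟨j, hx⟩)))
  · exact Or.inl (Or.inl (Or.inr rfl))
  · exact Or.inl (Or.inr rfl)
  · exact Or.inr (Or.inl (Or.inr hx))
  · exact Or.inr (Or.inr (Set.mem_iUnion.2 ⟨k, hx⟩))

/-- **The hull of `h` at a point without leak lies in `{h, u, p}` with the arms.** -/
theorem MixedBase.hull_mixedReal_subset (hup : ∃ e, ends e = s(u, p)) {q : Pt ι κ}
    (hqR : ¬ LeakR q) (hqB : ¬ LeakB q) :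
    hull ends (mixedReal ends u p U Ah F σ q) h ⊆ {h} ∪ {u} ∪ {p} ∪ armsAll U Ah F := by
  intro x hx
  rcases hx with hx | hx
  · rw [hb.cluster_mixedReal hup hqR] at hx
    exact redSetM_subset hx
  · rw [hb.cluster_blue_mixedReal hup hqB] at hx
    exact redSetM_subset hx

end Dual

end BigBlock

end Summit.Ventures.PercRepro2
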